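import Summits.QuantumFields.BalabanUV.Beta.EriceFlowEnclosureB12AsPrintedHistoryContagionShiftEnd
import Summits.QuantumFields.BalabanUV.Beta.EriceFlowEnclosureB12AsPrintedHistoryContagionOrder

/-!
# Beta / EriceFlowEnclosureB12AsPrintedHistoryContagionShiftOrder — ASYMPTOTIC FREEDOM IS CONTAGIOUS, part 7: on the as-printed carrier, under [I] THEOREM 2
# AS TYPED, the printed `Definitions`, NE4 and coupling-chart fading memory on a box of ANY size, THE CONTINUUM RUNNING COUPLING IS A MONOTONE FUNCTION OF
# THE RENORMALIZED COUPLING near zero: two families of rows pinned at g ≤ g′ below one threshold are ordered ROW BY ROW, INDEX BY INDEX (gen 35's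
# `bareCoupling_strictMono_bigBox` + `bare_lt_iff_renormalized_lt_bigBox`, prover 2's gen-44 forward order argument underneath), and the order passes to
# the continuum limit of part 6 at every physical scale — renormalization-group trajectories do not cross in the limit (β-flow team, prover 1 = recursion ∕
# upper ∕ bare-coupling ∕ uniqueness side, unit `b2b-balaban-beta-bflow-p1`, gen 36; ROW AP-I·Uc × NODE U2; parts 5∕6 `…HistoryContagionShift` ∕ `…ShiftEnd`)

HONEST FRAMING (page 1 of everything the β sub-cell writes): discharging `BetaPertH` makes Bałaban's UV stability UNCONDITIONAL — a
real constructive-QFT result; it is NOT the continuum limit and NOT the Clay problem.  HONEST DEPENDENCY (cell reorg 2026-08-19,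
verbatim): «continuum YM on T⁴ ⇐ BetaPertH ∧ nine spine estimates (0/9 proved); BetaPertH ⇐ (D1) ∧ (D4) ∧ CAP+tail; G-an2-4 gates
asym, D1 and NE2/3/4.»  THIS MODULE DISCHARGES NOTHING: a junction BY NAME of part 6 (`continuumCoupling_bigBox_of_typedTheorem2`,
`referenceFamily_of_typedTheorem2`) with gen 35's order theorems (`bareCoupling_strictMono_bigBox`, `bare_lt_iff_renormalized_lt_bigBox` — themselves over
prover 2's `…PointwiseFadingOrder.order_preserved`) and `le_of_tendsto_of_tendsto'`, over the NAMED FIELDS of `B12BetaAsPrinted` ([I] = T. Bałaban,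
Commun. Math. Phys. **109** (1987) [Balaban1987RG1]): `Theorem2Statement S hL` (Theorem 2 AS TYPED — STATED WITHOUT PROOF in print, p. 259; a
HYPOTHESIS), `Definitions` ((0.18)), the binder `hrg` ((0.20) along in-box rows).  The LETTERS `ScaleShiftRate` (NE4; NOT PRINTED, GAPS G-t4-U2-1) and
`HistLipschitz` ∕ `FadingMemory` (NOT PRINTED, GAPS G-t4-U2-2) are hypotheses on the abstract family `S.β`; NOTHING is asserted about Bałaban's β.
«Continuum running coupling» = the K → ∞ limit of the effective couplings of (0.20) at fixed physical scale (`T4ContinuumCoupling.gstar`), NOT the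
continuum limit of the measures.

WHAT THIS FILE PROVES (0 sorry, 0 def): **`rows_mono_of_typedTheorem2`** (two pinned row families at g ≤ g′ ≤ g₅ are ordered index by index at every
depth; strictly if g < g′; equal bare couplings if g = g′), **`gstar_mono_of_typedTheorem2`** (hence `gstar g m′ ≤ gstar g′ m′` at every physical scale m′).
STRICT monotonicity in the limit, with a two-sided quantitative law `(2∕3)Δ ≤ Δ(m′) ≤ (4∕3)Δ` in the chart 1∕g², is part 9 (`…HistoryContagionShiftPin`: a different,
sup-norm kernel over the contagion profiles — no `Definitions`, rows of any torus exponents); this part records what ORDER alone gives.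
NOT CLAIMED: any letter for Bałaban's β; Theorem 2; `BetaPertH`; continuum limit of the measures; Clay.
-/

namespace Summit.QuantumFields.BalabanUV.Beta.EriceFlowEnclosureB12AsPrintedHistoryContagionShiftOrder

open Finset Filter Topology
open Literature.MathematicalPhysics.QuantumFieldTheory.Balaban1983to89
open Literature.MathematicalPhysics.QuantumFieldTheory.Balaban1983to89.B12BetaAsPrinted
open Literature.MathematicalPhysics.QuantumFieldTheory.Balaban1983to89.FlowStep (RGEqH)
open Literature.MathematicalPhysics.QuantumFieldTheory.Balaban1983to89.T4CouplingMatching (HistLipschitz FadingMemory ScaleShiftRate)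
open Literature.MathematicalPhysics.QuantumFieldTheory.Balaban1983to89.T4ContinuumCoupling (gstar)
open Summit.QuantumFields.BalabanUV.Beta.EriceFlowEnclosureB12AsPrintedHistoryContagionOrder (bareCoupling_strictMono_bigBox
  bare_lt_iff_renormalized_lt_bigBox)
open Summit.QuantumFields.BalabanUV.Beta.EriceFlowEnclosureB12AsPrintedHistoryContagionShiftEnd (referenceFamily_of_typedTheorem2
  continuumCoupling_bigBox_of_typedTheorem2)

noncomputable section

variable {S : Setting}

/-- **PINNED ROW FAMILIES ARE ORDERED BY THEIR RENORMALIZED COUPLINGS, INDEX BY INDEX.**  `Theorem2Statement S hL` (a HYPOTHESIS), `Definitions`, the binder `hrg` on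
]0, γ_u] and the moduli `HistLipschitz Λ γ_u S.β`, `FadingMemory C θ Λ` (0 ≤ θ < 1, C ≥ 0; γ_u ARBITRARY against (C, θ)) ⟹ for every m there is g₅ > 0 such that two
families of rows (K, m, g₀ K), (K, m, g₀′ K) lying in ]0, γ_u], pinned at renormalized couplings g ≤ g′ ≤ g₅, satisfy `g_{K,j} ≤ g′_{K,j}` at EVERY depth K and EVERY
index j ≤ K (strictly if g < g′; the bare couplings — hence the rows — coincide if g = g′) — gen 35's `bare_lt_iff_renormalized_lt_bigBox` (g < g′ ⟹ g₀ K < g₀′ K)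
and `bareCoupling_strictMono_bigBox` (⟹ index-wise order), the reference rows from part 6's `referenceFamily_of_typedTheorem2`.
[cite: Balaban1987RG1, Thm 2 p.259 («g₀ = g₀(ε, g)») with (0.18)–(0.20) pp.255–256 and p.298] -/
theorem rows_mono_of_typedTheorem2 {hL : Odd S.L ∧ 1 < S.L} (h : Theorem2Statement S hL) (hD : Definitions S)
    {γu θ C : ℝ} {Λ : ℕ → ℕ → ℝ} (hγu : 0 < γu)
    (hrg : ∀ P : B12.RunParams, Step.InInterval γu P.K (S.cpl P) → RGEqH P.K S.β (S.cpl P))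
    (hL' : HistLipschitz Λ γu S.β) (hΛ : FadingMemory C θ Λ) (hθ0 : 0 ≤ θ) (hθ1 : θ < 1) (hC : 0 ≤ C) (m : ℕ) :
    ∃ g₅ : ℝ, 0 < g₅ ∧ ∀ (g₀ g₀' : ℕ → ℝ) (gIR gIR' : ℝ),
      (∀ K, Step.InInterval γu K (S.cpl ⟨K, m, g₀ K⟩)) → (∀ K, Step.InInterval γu K (S.cpl ⟨K, m, g₀' K⟩)) →
      (∀ K, S.cpl ⟨K, m, g₀ K⟩ K = gIR) → (∀ K, S.cpl ⟨K, m, g₀' K⟩ K = gIR') → gIR ≤ gIR' → gIR' ≤ g₅ →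
      (∀ K j, j ≤ K → S.cpl ⟨K, m, g₀ K⟩ j ≤ S.cpl ⟨K, m, g₀' K⟩ j) ∧
      (gIR < gIR' → ∀ K j, j ≤ K → S.cpl ⟨K, m, g₀ K⟩ j < S.cpl ⟨K, m, g₀' K⟩ j) ∧
      (gIR = gIR' → g₀ = g₀') := by
  obtain ⟨t₀, gs, bs, bs', hgs, hbs, -, -, hboxt, hpint, h031, -⟩ := referenceFamily_of_typedTheorem2 h hγu hrg m
  have hT' : ∀ K : ℕ, ∃ t : ℝ, Step.InInterval γu K (S.cpl ⟨K, m, t⟩) ∧ S.cpl ⟨K, m, t⟩ K = gs ∧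
      ∀ i, i ≤ K → 1 / gs ^ 2 + bs * ((K : ℝ) - i) ≤ 1 / (S.cpl ⟨K, m, t⟩ i) ^ 2 :=
    fun K => ⟨t₀ K, hboxt K, hpint K, h031 K⟩
  obtain ⟨g₂, hg₂, hmono⟩ := bareCoupling_strictMono_bigBox (m := m) hD hθ0 hθ1 hC hbs hrg hL' hΛ hT'
  obtain ⟨g₆, hg₆, hiff⟩ := bare_lt_iff_renormalized_lt_bigBox h hD hγu hrg hL' hΛ hθ0 hθ1 hC m
  refine ⟨min g₂ g₆, lt_min hg₂ hg₆, fun g₀ g₀' gIR gIR' hI hI' hend hend' hle hle' => ?_⟩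
  have hleK : ∀ K, S.cpl ⟨K, m, g₀ K⟩ K ≤ min g₂ g₆ := fun K => by rw [hend K]; exact hle.trans hle'
  have hleK' : ∀ K, S.cpl ⟨K, m, g₀' K⟩ K ≤ min g₂ g₆ := fun K => by rw [hend' K]; exact hle'
  have hstrict : gIR < gIR' → ∀ K j, j ≤ K → S.cpl ⟨K, m, g₀ K⟩ j < S.cpl ⟨K, m, g₀' K⟩ j := by
    intro hlt K j hj
    have hb : g₀ K < g₀' K := by
      refine (hiff K (g₀ K) (g₀' K) (hI K) (hI' K) ((hleK K).trans (min_le_right _ _)) ((hleK' K).trans (min_le_right _ _))).mpr ?_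
      rw [hend K, hend' K]; exact hlt
    exact hmono K (g₀ K) (g₀' K) (hI K) (hI' K) ((hleK K).trans (min_le_left _ _)) ((hleK' K).trans (min_le_left _ _)) hb j hj
  have hequal : gIR = gIR' → g₀ = g₀' := by
    intro heq
    funext K
    have hK := hiff K (g₀ K) (g₀' K) (hI K) (hI' K) ((hleK K).trans (min_le_right _ _)) ((hleK' K).trans (min_le_right _ _))
    have hK' := hiff K (g₀' K) (g₀ K) (hI' K) (hI K) ((hleK' K).trans (min_le_right _ _)) ((hleK K).trans (min_le_right _ _))
    rw [hend K, hend' K, heq] at hK hK'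
    rcases lt_trichotomy (g₀ K) (g₀' K) with h1 | h2 | h3
    · exact absurd (hK.mp h1) (lt_irrefl _)
    · exact h2
    · exact absurd (hK'.mp h3) (lt_irrefl _)
  refine ⟨fun K j hj => ?_, hstrict, hequal⟩
  rcases hle.eq_or_lt with heq | hlt
  · rw [hequal heq]
  · exact (hstrict hlt K j hj).le

/-- **THE CONTINUUM RUNNING COUPLING IS MONOTONE IN THE RENORMALIZED COUPLING.**  `Theorem2Statement S hL` (a HYPOTHESIS), `Definitions`, `hrg` on ]0, γ_u], NE4
`ScaleShiftRate c θ γ_u S.β` (c ≥ 0) and the moduli with fading memory (0 < θ < 1; γ_u ARBITRARY) ⟹ for every m there is g₅ > 0 such that two families of rows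
(K, m, g₀ K), (K, m, g₀′ K) in ]0, γ_u] pinned at g ≤ g′ ≤ g₅ have continuum running couplings (part 6) ordered at EVERY physical scale:
**`gstar g m′ ≤ gstar g′ m′`** — the index-wise order of `rows_mono_of_typedTheorem2` along the two families, passed to the limits of part 6's
`continuumCoupling_bigBox_of_typedTheorem2` (`le_of_tendsto_of_tendsto'`).  In the continuum limit of the effective couplings the trajectories issued from
different renormalized couplings do not cross (strictly: part 9). [cite: Balaban1987RG1, Thm 2 p.259 with (0.18)–(0.20) pp.255–256 and p.298] -/
theorem gstar_mono_of_typedTheorem2 {hL : Odd S.L ∧ 1 < S.L} (h : Theorem2Statement S hL) (hD : Definitions S)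
    {γu θ C c : ℝ} {Λ : ℕ → ℕ → ℝ} (hγu : 0 < γu)
    (hrg : ∀ P : B12.RunParams, Step.InInterval γu P.K (S.cpl P) → RGEqH P.K S.β (S.cpl P))
    (hS : ScaleShiftRate c θ γu S.β) (hL' : HistLipschitz Λ γu S.β) (hΛ : FadingMemory C θ Λ)
    (hθ0 : 0 < θ) (hθ1 : θ < 1) (hC : 0 ≤ C) (hc : 0 ≤ c) (m : ℕ) :
    ∃ g₅ : ℝ, 0 < g₅ ∧ ∀ (g₀ g₀' : ℕ → ℝ) (gIR gIR' : ℝ),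
      (∀ K, Step.InInterval γu K (S.cpl ⟨K, m, g₀ K⟩)) → (∀ K, Step.InInterval γu K (S.cpl ⟨K, m, g₀' K⟩)) →
      (∀ K, S.cpl ⟨K, m, g₀ K⟩ K = gIR) → (∀ K, S.cpl ⟨K, m, g₀' K⟩ K = gIR') → gIR ≤ gIR' → gIR' ≤ g₅ →
      ∀ m', gstar (fun K => S.cpl ⟨K, m, g₀ K⟩) m' ≤ gstar (fun K => S.cpl ⟨K, m, g₀' K⟩) m' := by
  obtain ⟨g₅, hg₅, hrows⟩ := rows_mono_of_typedTheorem2 h hD hγu hrg hL' hΛ hθ0.le hθ1 hC m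
  obtain ⟨g₂, b, b', hg₂, -, -, hall⟩ := continuumCoupling_bigBox_of_typedTheorem2 h hγu hrg hS hL' hΛ hθ0 hθ1 hC hc m
  refine ⟨min g₅ g₂, lt_min hg₅ hg₂, fun g₀ g₀' gIR gIR' hI hI' hend hend' hle hle' m' => ?_⟩
  obtain ⟨hmono, -, -⟩ := hrows g₀ g₀' gIR gIR' hI hI' hend hend' hle (hle'.trans (min_le_left _ _))
  obtain ⟨-, ht, -⟩ := hall (fun K => S.cpl ⟨K, m, g₀ K⟩) gIR (fun K => ⟨m, g₀ K, rfl⟩) hI hend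
    (hle.trans (hle'.trans (min_le_right _ _)))
  obtain ⟨-, ht', -⟩ := hall (fun K => S.cpl ⟨K, m, g₀' K⟩) gIR' (fun K => ⟨m, g₀' K, rfl⟩) hI' hend' (hle'.trans (min_le_right _ _))
  exact le_of_tendsto_of_tendsto' (ht m') (ht' m') fun n => hmono (n + m') n (Nat.le_add_right n m')

end

end Summit.QuantumFields.BalabanUV.Beta.EriceFlowEnclosureB12AsPrintedHistoryContagionShiftOrder
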